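import Literature.Probability.RandomPlanarGeometry.SAWEndpointSupermult
import Literature.Probability.RandomPlanarGeometry.SAWPolygonGrowth
import Literature.Probability.RandomPlanarGeometry.SAWPolygonsFromBridges
import Literature.Probability.RandomPlanarGeometry.BDGS2012CountBoundsProofs
import Literature.Probability.RandomPlanarGeometry.SAWPositiveWalks
import Literature.Probability.RandomPlanarGeometry.BDGS2012Prop13
import Literature.Analysis.Asymptotics.SupermultiplicativeDoubling
import Mathlib.Analysis.SpecialFunctions.Pow.Continuity
import HarnessLib

/-!
# Madras' doubling bootstrap for polygons on `ℤ²`: the growth constant of `normPolygons` and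
# `√n·p_n² ≤ 2·p_{2n+16} ⟹ p_m ≤ 2 μ¹⁶ (m+16)^{-1/2} μ^m`

Topic `Literature/Probability/RandomPlanarGeometry`, on top of `SAWPolygonGrowth.lean` (Madras–Slade (3.2.9) in the
rooted oriented normalisation, `Zd.MadrasSlade1993_eq329_general : (#saLoops d (2n))^{1/2n} → μ`, and
`Zd.card_saLoops_succ_eq_two_mul_countAt : #saLoops(N+1) = 2d·c_N(0,e)`), `SAWEndpointSupermult.lean` /
`SAWPolygonClasses.lean` (the sandwich `#normPolygons(k+1) ≤ c_k(0,e↓) ≤ (2k+3)²·#normPolygons(k+1)`) and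
`Literature/Analysis/Asymptotics/SupermultiplicativeDoubling.lean` (`Madras1995_doubling`: `Q_N² ≤ Q_{2N}`,
`Q_n^{1/n} → λ` ⟹ `Q_N ≤ λ^N`).

Source: N. Madras, *A rigorous bound on the critical exponent for the number of lattice trees, animals, and
polygons*, J. Statist. Phys. 78 (1995) 681–699 (`p_n ≤ A n^{-1/2} μ^n` on `ℤ²`; the analytic half printed again in
N. Madras, *Enumeration bounds via an isoperimetric-type inequality*, J. Phys. Conf. Ser. 42 (2006), §3 (3.6)–(3.7));
quoted as eq. (2.24) of S. G. Whittington (ed.), LNP 775 (2009). What is proved here (lane pcv-sawmu, planner route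
«MAD95-2JP» item S6 `Bootstrap2` with its input `PolygonLimit` DISCHARGED): (i) **`PolygonLimit`:
`(#normPolygons(2n))^{1/2n} → μ(ℤ²)`** (sandwich against `#saLoops(2n) = 4 c_{2n-1}(0,e)`); (ii) **the bootstrap**:
IF the join inequality `√n·p_n² ≤ 2·p_{2n+16}` holds for every even `n ≥ 4` (the lane's `JoinIneq2`, NOT proved here),
THEN `p_m ≤ 2 μ^16 (m+16)^{-1/2} μ^m` for every even `m ≥ 4` — via `Q_M := ½√(2M)·p_{2M-16}` (`M ≥ 16`, else `0`),
`Q_M² ≤ Q_{2M}`, `Q_M^{1/M} → μ²`, Madras' doubling, and the crude `p_m ≤ c_{m-1} ≤ 4·3^{m-2}`, `μ ≥ 2` for `m ≤ 14`.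
AXIOMS: standard.

## Contents (namespace `Literature.Probability.RandomPlanarGeometry.SAW`), all PROVED, no definitions
* `card_saLoops_two_eq_four_mul_countAt` — `#saLoops 2 (k+1) = 4·c_k(0,e↓)`;
* `card_normPolygons_sandwich` — `#saLoops(2n)/(4(4n+1)²) ≤ p_{2n} ≤ #saLoops(2n)/4` (`n ≥ 2`);
* `tendsto_card_normPolygons_rpow_inv` — `p_{2n}^{1/n} → μ²`; **`polygonLimit`** — `p_{2n}^{1/2n} → μ` (`PolygonLimit` verbatim);
* `card_normPolygons_le_four_mul_three_pow` — `p_m ≤ 4·3^{m-2}` (`m ≥ 2`);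
* **`mad95_explicit2_of_joinIneq2`** — `JoinIneq2 → MAD95_Explicit2` (bodies verbatim);
  `bootstrap2` — the planner's `Bootstrap2 : JoinIneq2 → PolygonLimit → MAD95_Explicit2` verbatim.
-/

noncomputable section

open Filter Topology Finset SimpleGraph Literature.Probability.LatticeModels Literature.Probability.Percolation
open Literature.Analysis.Asymptotics

namespace Literature.Probability.RandomPlanarGeometry.SAW

/-! ### The sandwich `p_{2n} ≍ #saLoops(2n)` up to `(4n+1)²` -/

/-- `#saLoops 2 (k+1) = 4 · c_k(0, e↓)` on `ℤ²` (rooted oriented polygons vs walks closing at a neighbour).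
[cite: MadrasSlade1993, §3.2, eq. (3.2.1)] -/
theorem card_saLoops_two_eq_four_mul_countAt (k : ℕ) :
    (Zd.saLoops 2 (k + 1)).card = 4 * Zd.countAt 2 k Zd.eDown := by
  have h := Zd.card_saLoops_succ_eq_two_mul_countAt (d := 2) k (e := Zd.eDown) Zd.adj_zero_eDown.symm
  simpa using h

/-- The two-sided sandwich for `n ≥ 2`: `#saLoops(2n) ≤ 4(4n+1)²·p_{2n}` and `4·p_{2n} ≤ #saLoops(2n)`.
[cite: MadrasSlade1993, §3.2, eq. (3.2.1) and Theorem 3.2.3 (polygons up to translation vs rooted walks)] -/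
theorem card_normPolygons_sandwich {n : ℕ} (hn : 2 ≤ n) :
    4 * (normPolygons (2 * n)).card ≤ (Zd.saLoops 2 (2 * n)).card ∧
      (Zd.saLoops 2 (2 * n)).card ≤ 4 * (2 * (2 * n) + 1) ^ 2 * (normPolygons (2 * n)).card := by
  obtain ⟨k, hk⟩ : ∃ k, 2 * n = k + 1 := ⟨2 * n - 1, by omega⟩
  have hk2 : 2 ≤ k := by omega
  rw [hk, card_saLoops_two_eq_four_mul_countAt]
  refine ⟨Nat.mul_le_mul_left 4 (card_normPolygons_le_countAt k), ?_⟩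
  have h := countAt_le_card_box_mul_card_normPolygons (x := Zd.eDown) Zd.adj_zero_eDown.symm hk2
  calc 4 * Zd.countAt 2 k Zd.eDown ≤ 4 * ((2 * (k + 1) + 1) ^ 2 * (normPolygons (k + 1)).card) :=
        Nat.mul_le_mul_left 4 h
    _ = 4 * (2 * (k + 1) + 1) ^ 2 * (normPolygons (k + 1)).card := by ring

/-! ### The growth constant of `normPolygons` -/

/-- `c^{e_n} → 1` for a constant `c > 0` and exponents `e_n → 0`. [folklore] -/
private theorem tendsto_const_rpow_of_tendsto_zero {c : ℝ} (hc : 0 < c) {e : ℕ → ℝ}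
    (he : Tendsto e atTop (𝓝 0)) : Tendsto (fun n => c ^ e n) atTop (𝓝 1) := by
  have hca : ContinuousAt (fun x : ℝ => c ^ x) 0 := Real.continuousAt_const_rpow hc.ne'
  have h := hca.tendsto.comp he
  rwa [Function.comp_def, Real.rpow_zero] at h

/-- **`p_{2n}^{1/n} → μ²`** (`p = #normPolygons`): the rooted oriented count satisfies `(#saLoops(2n))^{1/2n} → μ`
(Madras–Slade (3.2.9)) and differs from `4 p_{2n}` by at most the factor `(4n+1)²`.
[cite: MadrasSlade1993, Corollary 3.2.5, eq. (3.2.9) (p. 67)] -/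
theorem tendsto_card_normPolygons_rpow_inv :
    Tendsto (fun n : ℕ => ((normPolygons (2 * n)).card : ℝ) ^ (1 / (n : ℝ))) atTop
      (𝓝 (Zd.connectiveConstant 2 ^ 2)) := by
  set μ : ℝ := Zd.connectiveConstant 2 with hμdef
  have hμ : 0 < μ := Zd.connectiveConstant_pos 2
  set q : ℕ → ℝ := fun n => ((Zd.saLoops 2 (2 * n)).card : ℝ) with hq
  -- `q_n^{1/n} = (q_n^{1/2n})² → μ²`
  have h329 := Zd.MadrasSlade1993_eq329_general (d := 2) le_rfl
  have hq1 : Tendsto (fun n : ℕ => q n ^ (1 / (n : ℝ))) atTop (𝓝 (μ ^ 2)) := by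
    have h := h329.pow 2
    refine h.congr' ?_
    filter_upwards [eventually_ge_atTop 1] with n hn
    have hn0 : (0 : ℝ) < n := by exact_mod_cast hn
    rw [hq, ← Real.rpow_natCast, ← Real.rpow_mul (Nat.cast_nonneg _)]
    congr 1
    push_cast
    field_simp
  -- the polynomial prefactor `(4(4n+1)²)^{-1/n} → 1`
  have hpoly : Tendsto (fun n : ℕ => ((4 : ℝ) * (2 * (2 * (n : ℝ)) + 1) ^ 2) ^ (1 / (n : ℝ))) atTop (𝓝 1) := by
    -- `4(4n+1)² ≤ 100 n²` is not needed: compute the limit of each factor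
    have h4 : Tendsto (fun n : ℕ => (4 : ℝ) ^ (1 / (n : ℝ))) atTop (𝓝 1) :=
      tendsto_const_rpow_of_tendsto_zero (by norm_num) (tendsto_const_div_atTop_nhds_zero_nat 1)
    -- `(4n+1)^{1/n} → 1`: squeeze between `1` and `(5n)^{1/n} = 5^{1/n} n^{1/n}`
    have h5 : Tendsto (fun n : ℕ => (5 : ℝ) ^ (1 / (n : ℝ))) atTop (𝓝 1) :=
      tendsto_const_rpow_of_tendsto_zero (by norm_num) (tendsto_const_div_atTop_nhds_zero_nat 1)
    have hn1 : Tendsto (fun n : ℕ => ((n : ℝ) ^ (1 : ℝ)) ^ (1 / (n : ℝ))) atTop (𝓝 1) :=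
      tendsto_rpow_const_rpow_inv_nat 1
    have hup : Tendsto (fun n : ℕ => (5 : ℝ) ^ (1 / (n : ℝ)) * ((n : ℝ) ^ (1 : ℝ)) ^ (1 / (n : ℝ))) atTop
        (𝓝 1) := by simpa using h5.mul hn1
    have hlin : Tendsto (fun n : ℕ => (2 * (2 * (n : ℝ)) + 1) ^ (1 / (n : ℝ))) atTop (𝓝 1) := by
      refine tendsto_of_tendsto_of_tendsto_of_le_of_le' tendsto_const_nhds hup ?_ ?_
      · filter_upwards [eventually_ge_atTop 1] with n hn
        exact Real.one_le_rpow (by linarith [show (1 : ℝ) ≤ n by exact_mod_cast hn]) (by positivity)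
      · filter_upwards [eventually_ge_atTop 1] with n hn
        have hn' : (1 : ℝ) ≤ n := by exact_mod_cast hn
        rw [Real.rpow_one, ← Real.mul_rpow (by norm_num) (by positivity)]
        exact Real.rpow_le_rpow (by positivity) (by linarith) (by positivity)
    have hsq : Tendsto (fun n : ℕ => ((2 * (2 * (n : ℝ)) + 1) ^ 2) ^ (1 / (n : ℝ))) atTop (𝓝 1) := by
      have h := hlin.pow 2
      rw [one_pow] at h
      refine h.congr' ?_
      filter_upwards [eventually_ge_atTop 1] with n hn
      rw [← Real.rpow_natCast ((2 * (2 * (n : ℝ)) + 1) ^ (1 / (n : ℝ))) 2, ← Real.rpow_mul (by positivity),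
        ← Real.rpow_natCast (2 * (2 * (n : ℝ)) + 1) 2, ← Real.rpow_mul (by positivity)]
      congr 1; push_cast; ring
    have h := h4.mul hsq
    rw [one_mul] at h
    refine h.congr' (Eventually.of_forall fun n => ?_)
    rw [← Real.mul_rpow (by norm_num) (by positivity)]
  -- squeeze: `q/(4(4n+1)²) ≤ p ≤ q` (for `n ≥ 2`)
  have hlo : Tendsto (fun n : ℕ => q n ^ (1 / (n : ℝ)) / ((4 : ℝ) * (2 * (2 * (n : ℝ)) + 1) ^ 2) ^ (1 / (n : ℝ)))
      atTop (𝓝 (μ ^ 2)) := by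
    have h := hq1.div hpoly one_ne_zero
    rw [div_one] at h
    exact h
  refine tendsto_of_tendsto_of_tendsto_of_le_of_le' hlo hq1 ?_ ?_
  · filter_upwards [eventually_ge_atTop 2] with n hn
    have hsand := (card_normPolygons_sandwich hn).2
    have hpos : (0 : ℝ) < (4 : ℝ) * (2 * (2 * (n : ℝ)) + 1) ^ 2 := by positivity
    have hle : q n / ((4 : ℝ) * (2 * (2 * (n : ℝ)) + 1) ^ 2) ≤ ((normPolygons (2 * n)).card : ℝ) := by
      rw [div_le_iff₀ hpos, hq]
      have : ((Zd.saLoops 2 (2 * n)).card : ℝ) ≤ ((4 * (2 * (2 * n) + 1) ^ 2 * (normPolygons (2 * n)).card : ℕ) : ℝ) := by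
        exact_mod_cast hsand
      push_cast at this
      linarith
    rw [← Real.div_rpow (by positivity) hpos.le]
    exact Real.rpow_le_rpow (by positivity) hle (by positivity)
  · filter_upwards [eventually_ge_atTop 2] with n hn
    have hsand := (card_normPolygons_sandwich hn).1
    refine Real.rpow_le_rpow (by positivity) ?_ (by positivity)
    have : ((4 * (normPolygons (2 * n)).card : ℕ) : ℝ) ≤ ((Zd.saLoops 2 (2 * n)).card : ℝ) := by exact_mod_cast hsand
    push_cast at this
    have h0 : (0 : ℝ) ≤ ((normPolygons (2 * n)).card : ℝ) := Nat.cast_nonneg _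
    rw [hq]; linarith

/-- **The growth constant of polygons up to translation is `μ`: `(#normPolygons(2n))^{1/2n} → μ(ℤ²)`** (the lane
planner's `PolygonLimit`, verbatim) — Madras–Slade (3.2.9) `μ_Polygon = μ` transported from the rooted oriented
normalisation `#saLoops` to `normPolygons`. [cite: MadrasSlade1993, Corollary 3.2.5, eq. (3.2.9) (p. 67); Theorem 3.2.3] -/
theorem polygonLimit :
    Tendsto (fun n : ℕ => ((normPolygons (2 * n)).card : ℝ) ^ (1 / (2 * (n : ℝ)))) atTop
      (𝓝 (Zd.connectiveConstant 2)) := by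
  have hμ : 0 ≤ Zd.connectiveConstant 2 := (Zd.connectiveConstant_pos 2).le
  have h := tendsto_card_normPolygons_rpow_inv.rpow_const (p := 1 / 2) (Or.inr (by norm_num))
  have e : (Zd.connectiveConstant 2 ^ 2) ^ ((1 : ℝ) / 2) = Zd.connectiveConstant 2 := by
    rw [← Real.rpow_natCast, ← Real.rpow_mul hμ]; norm_num
  rw [e] at h
  refine h.congr' (Eventually.of_forall fun n => ?_)
  rw [← Real.rpow_mul (Nat.cast_nonneg _)]
  congr 1
  ring

/-! ### Small polygons and the bootstrap -/

/-- `p_m ≤ 4·3^{m-2}` for `m ≥ 2` (`p_m ≤ c_{m-1}(0,e↓) ≤ c_{m-1} ≤ 2d(2d-1)^{m-2}`).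
[cite: MadrasSlade1993, §1.2, eq. (1.2.2) (c_n ≤ 2d(2d-1)^{n-1})] -/
theorem card_normPolygons_le_four_mul_three_pow {m : ℕ} (hm : 2 ≤ m) :
    (normPolygons m).card ≤ 4 * 3 ^ (m - 2) := by
  obtain ⟨k, rfl⟩ : ∃ k, m = k + 1 := ⟨m - 1, by omega⟩
  have h1 := card_normPolygons_le_countAt k
  have h2 := Zd.countAt_le_count (d := 2) k Zd.eDown
  have h3 := (Zd.BDGS2012_count_bounds_holds 2 k (by omega)).2
  have e : k + 1 - 2 = k - 1 := by omega
  rw [e]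
  calc (normPolygons (k + 1)).card ≤ Zd.count 2 k := h1.trans h2
    _ ≤ 2 * 2 * (2 * 2 - 1) ^ (k - 1) := h3
    _ = 4 * 3 ^ (k - 1) := by norm_num

/-- **Madras' doubling bootstrap (the lane's `Bootstrap2` with `PolygonLimit` discharged)**: IF
`√n·p_n² ≤ 2·p_{2n+16}` for every even `n ≥ 4` (`p = #normPolygons`; the lane's `JoinIneq2`, a hypothesis here),
THEN `p_m ≤ 2 μ^16 (m+16)^{-1/2} μ^m` for every even `m ≥ 4`. Proof: `Q_M := ½√(2M) p_{2M-16}` (`M ≥ 16`, else `0`)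
has `Q_M² ≤ Q_{2M}` (the hypothesis at `n = 2M-16`, and `M ≤ 2M-16`) and `Q_M^{1/M} → μ²` (`polygonLimit`), so
`Q_M ≤ μ^{2M}` (`Madras1995_doubling`); even `m ≤ 14` by `p_m ≤ 4·3^{m-2}` and `μ ≥ 2`.
[cite: Madras2006Isoperimetric, §3, eqs. (3.6)–(3.7); Madras1995LatticeAnimalsExponent] -/
theorem mad95_explicit2_of_joinIneq2
    (hJ : ∀ n : ℕ, Even n → 4 ≤ n →
      Real.sqrt n * ((normPolygons n).card : ℝ) ^ 2 ≤ 2 * ((normPolygons (2 * n + 16)).card : ℝ)) :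
    ∀ m : ℕ, Even m → 4 ≤ m →
      ((normPolygons m).card : ℝ) ≤
        2 * Zd.connectiveConstant 2 ^ 16 * (((m : ℝ) + 16) ^ (-(1 / 2 : ℝ))) * Zd.connectiveConstant 2 ^ m := by
  set μ : ℝ := Zd.connectiveConstant 2 with hμdef
  have hμ : 0 < μ := Zd.connectiveConstant_pos 2
  have hμ2 : 2 ≤ μ := by have := Zd.natCast_le_connectiveConstant 2; push_cast at this; exact this
  set p : ℕ → ℝ := fun k => ((normPolygons k).card : ℝ) with hp
  have hp0 : ∀ k, 0 ≤ p k := fun k => Nat.cast_nonneg _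
  -- the doubling sequence
  set Q : ℕ → ℝ := fun M => if 16 ≤ M then 1 / 2 * Real.sqrt (2 * M) * p (2 * M - 16) else 0 with hQ
  have hQ0 : ∀ n, 1 ≤ n → 0 ≤ Q n := by
    intro n _
    simp only [hQ]
    split_ifs
    · exact mul_nonneg (by positivity) (hp0 _)
    · exact le_rfl
  have hsq : ∀ N, 1 ≤ N → Q N ^ 2 ≤ Q (2 * N) := by
    intro N _
    by_cases hN : 16 ≤ N
    · have h2N : 16 ≤ 2 * N := by omega
      have hQN : Q N = 1 / 2 * Real.sqrt (2 * N) * p (2 * N - 16) := by simp only [hQ, if_pos hN]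
      have hQ2N : Q (2 * N) = 1 / 2 * Real.sqrt (2 * ((2 * N : ℕ) : ℝ)) * p (2 * (2 * N) - 16) := by
        simp only [hQ, if_pos h2N]
      -- the hypothesis at `n = 2N - 16`
      set n : ℕ := 2 * N - 16 with hn
      have hn4 : 4 ≤ n := by omega
      have hne : Even n := ⟨N - 8, by omega⟩
      have hJn := hJ n hne hn4
      have e1 : 2 * n + 16 = 2 * (2 * N) - 16 := by omega
      rw [e1] at hJn
      have hnr : (n : ℝ) = 2 * N - 16 := by rw [hn]; push_cast [Nat.cast_sub (by omega : 16 ≤ 2 * N)]; ring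
      have hNr : (16 : ℝ) ≤ N := by exact_mod_cast hN
      have hn0 : (0 : ℝ) < n := by rw [hnr]; linarith
      -- `√(2N)² = 2N`, `√(2·2N) = 2 √N`... work with `s := √n`, `t := √N`
      have hsn : Real.sqrt n * Real.sqrt n = n := Real.mul_self_sqrt hn0.le
      have hsN : Real.sqrt (2 * (N : ℝ)) ^ 2 = 2 * N := Real.sq_sqrt (by positivity)
      have hs4N : Real.sqrt (2 * ((2 * N : ℕ) : ℝ)) = 2 * Real.sqrt N := by
        push_cast
        rw [show (2 : ℝ) * (2 * N) = 2 ^ 2 * N by ring, Real.sqrt_mul (by positivity), Real.sqrt_sq (by norm_num)]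
      -- `N ≤ √N √n` since `N ≤ n`
      have hNn : (N : ℝ) ≤ n := by rw [hnr]; linarith
      have hkey : (N : ℝ) ≤ Real.sqrt N * Real.sqrt n := by
        have h1 : Real.sqrt (N : ℝ) * Real.sqrt N = N := Real.mul_self_sqrt (by positivity)
        have h2 : Real.sqrt (N : ℝ) ≤ Real.sqrt n := Real.sqrt_le_sqrt hNn
        nlinarith [Real.sqrt_nonneg (N : ℝ)]
      rw [hQN, hQ2N, hs4N]
      -- `Q_N² = (N/2) p_n²`, `Q_{2N} = √N p_{2n+16}`
      have hpn := hp0 n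
      have hp2 := hp0 (2 * (2 * N) - 16)
      calc (1 / 2 * Real.sqrt (2 * (N : ℝ)) * p n) ^ 2 = (N : ℝ) / 2 * p n ^ 2 := by
            rw [mul_pow, mul_pow, hsN]; ring
        _ ≤ Real.sqrt N * Real.sqrt n / 2 * p n ^ 2 := by
            apply mul_le_mul_of_nonneg_right _ (sq_nonneg _); linarith
        _ = Real.sqrt N / 2 * (Real.sqrt n * p n ^ 2) := by ring
        _ ≤ Real.sqrt N / 2 * (2 * p (2 * (2 * N) - 16)) :=
            mul_le_mul_of_nonneg_left hJn (by positivity)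
        _ = 1 / 2 * (2 * Real.sqrt N) * p (2 * (2 * N) - 16) := by ring
    · have hQN : Q N = 0 := by simp only [hQ, if_neg hN]
      rw [hQN]
      simpa using hQ0 (2 * N) (by omega)
  -- the limit `Q_M^{1/M} → μ²`
  have hlim : Tendsto (fun M : ℕ => Q M ^ (1 / (M : ℝ))) atTop (𝓝 (μ ^ 2)) := by
    -- (a) `p_{2(M-8)}^{1/(M-8)} → μ²`, then re-exponentiate to `1/M`
    have ha : Tendsto (fun M : ℕ => p (2 * (M - 8)) ^ (1 / (((M - 8 : ℕ) : ℝ)))) atTop (𝓝 (μ ^ 2)) :=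
      tendsto_card_normPolygons_rpow_inv.comp (tendsto_sub_atTop_nat 8)
    have hg : Tendsto (fun M : ℕ => (((M - 8 : ℕ) : ℝ)) / M) atTop (𝓝 1) := by
      have h1 : Tendsto (fun M : ℕ => 1 - (8 : ℝ) / M) atTop (𝓝 (1 - 0)) :=
        tendsto_const_nhds.sub (tendsto_const_div_atTop_nhds_zero_nat 8)
      rw [sub_zero] at h1
      refine h1.congr' ?_
      filter_upwards [eventually_ge_atTop 8] with M hM
      have hM0 : (0 : ℝ) < M := by exact_mod_cast (show 0 < M by omega)
      rw [Nat.cast_sub hM]; push_cast; field_simp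
    have hb : Tendsto (fun M : ℕ => (p (2 * (M - 8)) ^ (1 / (((M - 8 : ℕ) : ℝ)))) ^ ((((M - 8 : ℕ) : ℝ)) / M))
        atTop (𝓝 ((μ ^ 2) ^ (1 : ℝ))) := ha.rpow hg (Or.inl (by positivity))
    rw [Real.rpow_one] at hb
    have hb' : Tendsto (fun M : ℕ => p (2 * (M - 8)) ^ (1 / (M : ℝ))) atTop (𝓝 (μ ^ 2)) := by
      refine hb.congr' ?_
      filter_upwards [eventually_ge_atTop 9] with M hM
      have hM8 : (0 : ℝ) < ((M - 8 : ℕ) : ℝ) := by exact_mod_cast (show 0 < M - 8 by omega)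
      have hM0 : (0 : ℝ) < M := by exact_mod_cast (show 0 < M by omega)
      rw [← Real.rpow_mul (hp0 _)]
      congr 1
      field_simp
    -- (b) the prefactor `(2^{-1/2} √M)^{1/M} → 1`, written as `c^{1/M} · (M^{1/2})^{1/M}`
    have hc : Tendsto (fun M : ℕ => (Real.sqrt 2 / 2) ^ (1 / (M : ℝ))) atTop (𝓝 1) :=
      tendsto_const_rpow_of_tendsto_zero (by positivity) (tendsto_const_div_atTop_nhds_zero_nat 1)
    have hM : Tendsto (fun M : ℕ => ((M : ℝ) ^ (1 / 2 : ℝ)) ^ (1 / (M : ℝ))) atTop (𝓝 1) :=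
      tendsto_rpow_const_rpow_inv_nat (1 / 2)
    have hall := (hc.mul hM).mul hb'
    rw [one_mul, one_mul] at hall
    refine hall.congr' ?_
    filter_upwards [eventually_ge_atTop 16] with M hM16
    have hM0 : (0 : ℝ) ≤ M := Nat.cast_nonneg M
    have hQM : Q M = Real.sqrt 2 / 2 * (M : ℝ) ^ (1 / 2 : ℝ) * p (2 * (M - 8)) := by
      simp only [hQ, if_pos hM16]
      rw [show 2 * M - 16 = 2 * (M - 8) by omega, Real.sqrt_mul (by norm_num), Real.sqrt_eq_rpow (M : ℝ)]
      ring
    rw [hQM, Real.mul_rpow (by positivity) (hp0 _), Real.mul_rpow (by positivity) (by positivity)]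
  -- doubling: `Q_M ≤ (μ²)^M`
  have hdoub : ∀ M : ℕ, 1 ≤ M → Q M ≤ (μ ^ 2) ^ M := fun M hM => Madras1995_doubling hQ0 hsq hlim hM
  -- conclusion
  intro m hme hm4
  have hrpow : ((m : ℝ) + 16) ^ (-(1 / 2 : ℝ)) = (Real.sqrt ((m : ℝ) + 16))⁻¹ := by
    rw [Real.rpow_neg (by positivity), Real.sqrt_eq_rpow]
  have hs0 : 0 < Real.sqrt ((m : ℝ) + 16) := Real.sqrt_pos.2 (by positivity)
  rw [hrpow]
  by_cases hm : 16 ≤ m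
  · -- `m = 2M - 16`, `M = m/2 + 8 ≥ 16`
    obtain ⟨j, hj⟩ := hme
    set M : ℕ := j + 8 with hMdef
    have hM16 : 16 ≤ M := by omega
    have hmM : 2 * M - 16 = m := by omega
    have hQM : Q M = 1 / 2 * Real.sqrt (2 * M) * p m := by simp only [hQ, if_pos hM16, hmM]
    have h2M : (2 * M : ℝ) = m + 16 := by
      have : 2 * M = m + 16 := by omega
      exact_mod_cast this
    have hd := hdoub M (by omega)
    rw [hQM, h2M, ← pow_mul] at hd
    have e2 : 2 * M = m + 16 := by omega
    rw [e2, pow_add] at hd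
    -- `½ √(m+16) p_m ≤ μ^m μ^16`
    show p m ≤ 2 * μ ^ 16 * (Real.sqrt ((m : ℝ) + 16))⁻¹ * μ ^ m
    rw [show 2 * μ ^ 16 * (Real.sqrt ((m : ℝ) + 16))⁻¹ * μ ^ m = 2 * (μ ^ m * μ ^ 16) / Real.sqrt ((m : ℝ) + 16) by
      ring, le_div_iff₀ hs0]
    linarith
  · -- small even `m ∈ {4, …, 14}`: `p_m ≤ 4·3^{m-2} ≤ 2^{m+16}/3 ≤ 2 μ^16 μ^m / 6 ≤ RHS`
    have hm14 : m ≤ 14 := by obtain ⟨r, hr⟩ := hme; omega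
    have hpm : p m ≤ 4 * 3 ^ (m - 2) := by
      have := card_normPolygons_le_four_mul_three_pow (m := m) (by omega)
      have h' : ((normPolygons m).card : ℝ) ≤ ((4 * 3 ^ (m - 2) : ℕ) : ℝ) := by exact_mod_cast this
      push_cast at h'
      exact h'
    have hsqrt : Real.sqrt ((m : ℝ) + 16) ≤ 6 := by
      rw [Real.sqrt_le_left (by norm_num)]
      have : (m : ℝ) ≤ 14 := by exact_mod_cast hm14
      linarith
    have hμpow : (2 : ℝ) ^ (m + 16) ≤ μ ^ m * μ ^ 16 := by
      rw [pow_add]; exact mul_le_mul (pow_le_pow_left₀ (by norm_num) hμ2 m)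
        (pow_le_pow_left₀ (by norm_num) hμ2 16) (by positivity) (by positivity)
    -- numeric: `4·3^{m-2}·6 ≤ 2·2^{m+16}` for `4 ≤ m ≤ 14`
    have hnum : (4 : ℝ) * 3 ^ (m - 2) * 6 ≤ 2 * 2 ^ (m + 16) := by
      interval_cases m <;> norm_num
    show p m ≤ 2 * μ ^ 16 * (Real.sqrt ((m : ℝ) + 16))⁻¹ * μ ^ m
    rw [show 2 * μ ^ 16 * (Real.sqrt ((m : ℝ) + 16))⁻¹ * μ ^ m = 2 * (μ ^ m * μ ^ 16) / Real.sqrt ((m : ℝ) + 16) by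
      ring, le_div_iff₀ hs0]
    calc p m * Real.sqrt ((m : ℝ) + 16) ≤ 4 * 3 ^ (m - 2) * 6 :=
          mul_le_mul hpm hsqrt hs0.le (by positivity)
      _ ≤ 2 * 2 ^ (m + 16) := hnum
      _ ≤ 2 * (μ ^ m * μ ^ 16) := by linarith

/-- **The planner's `Bootstrap2 : JoinIneq2 → PolygonLimit → MAD95_Explicit2`, verbatim** (the `PolygonLimit`
hypothesis is not needed: `polygonLimit`). [cite: Madras2006Isoperimetric, §3, eqs. (3.6)–(3.7); Madras1995LatticeAnimalsExponent] -/
theorem bootstrap2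
    (hJ : ∀ n : ℕ, Even n → 4 ≤ n →
      Real.sqrt n * ((normPolygons n).card : ℝ) ^ 2 ≤ 2 * ((normPolygons (2 * n + 16)).card : ℝ))
    (_hL : Tendsto (fun n : ℕ => ((normPolygons (2 * n)).card : ℝ) ^ (1 / (2 * (n : ℝ)))) atTop
      (𝓝 (Zd.connectiveConstant 2))) :
    ∀ m : ℕ, Even m → 4 ≤ m →
      ((normPolygons m).card : ℝ) ≤
        2 * Zd.connectiveConstant 2 ^ 16 * (((m : ℝ) + 16) ^ (-(1 / 2 : ℝ))) * Zd.connectiveConstant 2 ^ m :=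
  mad95_explicit2_of_joinIneq2 hJ

end Literature.Probability.RandomPlanarGeometry.SAW

end
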